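import Literature.Computability.Cryptography.MLKEMCompression
import Literature.Computability.Cryptography.ModuleLWR
import Literature.Computability.Cryptography.LWEProductLaws
import HarnessLib

/-!
# The Module-LWER problem of the Kyber specification (compressed Module-LWE samples)

Topic `Computability/Cryptography`. CRYSTALS-Kyber specification (v3.02), §4.4 "Estimated security
strength", verbatim (p. 21–22):

> "We define the Module-LWER problem as the problem of distinguishing samples `(aᵢ, Compress_q(bᵢ, d))`
> for random `(aᵢ, bᵢ) ← R_q^k × R_q` from samples where `aᵢ ← R_q^k` and `bᵢ = aᵢᵀ s + eᵢ` with
> `s ← B^k_{η₁}` common to all samples and `eᵢ ← B_{η₂}` fresh for every sample. Using the same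
> terminology as in the beginning of Section 4.3, we define the advantage of an algorithm `A` breaking
> Module-LWER as `Adv^{mlwer}_{m,k,η₁,η₂,d}(A) = |Pr[b′ = 1 : A ← R_q^{m×k}; (s, e) ← β^k_{η₁} × β^m_{η₂};
> b = As + e; b′ ← A(A, Compress_q(b, d))] − Pr[b′ = 1 : A ← R_q^{m×k}; b ← R_q^m;
> b′ ← A(A, Compress_q(b, d))]|`. […] First, when `η₁ ≥ η₂`, any algorithm `B` for Module-LWE implies
> an algorithm `A` for Module-LWER such that `Adv^{mlwer}_{m,k,η₁,η₂,d}(A) ≤ Adv^{mlwe}_{m,k,η₂}(B)`."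
> [AvanziEtAl2021KyberSpec, §4.4]

Here `Compress_q(·, d)` is applied to an element of `R_q` COEFFICIENT-WISE (§1.1: "the procedure is
applied to each coefficient individually"), i.e. it is `RingLWR.roundCoords b q (2^d)` of `ModuleLWR.lean`
(each coordinate in the `ℤ`-basis `b` of `𝓞 K` rounded by `MLKEM.compress q d = LWR.roundTo q (2^d)`).

## Contents

* `RingLWE.binomialMLWESamples₂ b q k η₁ η₂ m` — the two-parameter MLWE branch `(A, As + e)`,
  `s ← β^k_{η₁}`, `e ← β^m_{η₂}` (for `η₁ = η₂ = η` this is the tree's `binomialMLWESamples`, `rfl`),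
  and its advantage `binomialMLWEAdvantage₂`;
* `MLKEM.compressRq b q d : R_q → ℤ_{2^d}^n` — coefficient-wise `Compress_q(·, d)`
  (`= RingLWR.roundCoords b q (2^d)`), `MLKEM.lwerView` — `(aᵢ, bᵢ)ᵢ ↦ (aᵢ, Compress_q(bᵢ, d))ᵢ`;
* `MLKEM.mlwerAdvantage b q k η₁ η₂ d m A` — the displayed `Adv^{mlwer}_{m,k,η₁,η₂,d}(A)`;
* **`MLKEM.mlwerAdvantage_eq_mlweAdvantage₂`** — the exact content of the reduction direction that needs
  no heuristic: an MLWER distinguisher `A` IS an MLWE distinguisher (compose with the public map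
  `Compress`), `Adv^{mlwer}_{m,k,η₁,η₂,d}(A) = Adv^{mlwe}_{m,k,η₁,η₂}(A ∘ Compress)`; in particular
  (`mlwerAdvantage_le`) Module-LWER with parameters `(η₁, η₂)` is at least as hard as Module-LWE with the
  SAME `(η₁, η₂)`;
* **`MLKEM.mlwerAdvantage_eq_mlweAdvantage_rerandThen`**, **`MLKEM.exists_mlwe_of_mlwer`** — the PRINTED
  inequality with `Adv^{mlwe}_{m,k,η₂}` on the right: for `η₁ ≥ η₂` and every MLWER adversary `A` the
  explicit MLWE distinguisher `rerandThen A` (re-randomise the secret by a fresh `t ← β^k_{η₁−η₂}` through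
  Regev's shift `(aᵢ, bᵢ) ↦ (aᵢ, bᵢ + ⟨aᵢ, t⟩)`, compress, run `A`) has
  `Adv^{mlwe}_{m,k,η₂}(rerandThen A) = Adv^{mlwer}_{m,k,η₁,η₂,d}(A)`, via the additivity of the centred
  binomial law in `η` (`centeredBinomial_add`, `RingLWE.binomialRq_add`: `B_{η₂+δ} = B_{η₂} ⋆ B_δ`);
  ML-KEM-512 instance `MLKEM.mlkem512_exists_mlwe_of_mlwer` (`(k, η₁, η₂, d_u) = (2, 3, 2, 10)`, the
  designers' "Core-SVP 112 / log₂ gates ≈ 145" reading). The 'Module-LWER is somewhat harder' discussion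
  (Table 5, heuristic (7)) is NOT formalised.

## References

* R. Avanzi et al., *CRYSTALS-Kyber, Algorithm Specifications and Supporting Documentation* (v3.02,
  2021-08-04): §1.1 (`B_η`; Compress coefficient-wise), §4.3 (`Adv^{mlwe}_{m,k,η}`), §4.4 eq. (6) context,
  the Module-LWER definition and the inequality `Adv^{mlwer} ≤ Adv^{mlwe}_{m,k,η₂}` (pp. 21–22). Held as
  paper:url-5bd2326281fb (p0021–p0022). [AvanziEtAl2021KyberSpec]
* O. Regev, *On lattices, learning with errors, random linear codes, and cryptography*, J. ACM 56
  (2009), §4, proof of Lemma 4.1 (the shift `(a, b) ↦ (a, b + ⟨a, t⟩)`; the tree's `LWE.shiftSample`).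
  [RegevLWE2009]
-/

noncomputable section

open scoped NumberField
open NumberField

namespace Literature.Computability.Cryptography

variable {K : Type} [Field K] [NumberField K] {n : ℕ} (b : Module.Basis (Fin n) ℤ (𝓞 K))
  (q : ℕ) [NeZero q]

namespace RingLWE

/-- The MLWE branch with SEPARATE secret and error widths: `s ← β^k_{η₁}`, then `m` samples
`(aᵢ, ⟨aᵢ, s⟩ + eᵢ)`, `aᵢ ← U(R_q^k)`, `eᵢ ← β_{η₂}` (Kyber spec §4.4: "`(s, e) ← β^k_{η₁} × β^m_{η₂}`").
[cite: AvanziEtAl2021KyberSpec, §4.4 (Adv^mlwer: (s, e) ← β^k_{η₁} × β^m_{η₂})] -/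
def binomialMLWESamples₂ (k η₁ η₂ m : ℕ) : PMF (Fin m → (Fin k → Rq K q) × Rq K q) :=
  (LWE.iidPMF (binomialRq b q η₁) k).bind fun s ↦ LWE.lweSamples (binomialRq b q η₂) s m

/-- For `η₁ = η₂ = η` this is the tree's one-parameter MLWE branch `binomialMLWESamples`.
[cite: AvanziEtAl2021KyberSpec, §4.3 (Adv^mlwe_{m,k,η})] -/
theorem binomialMLWESamples₂_self (k η m : ℕ) :
    binomialMLWESamples₂ b q k η η m = binomialMLWESamples b q k η m := rfl

/-- The two-parameter Module-LWE advantage `Adv^{mlwe}_{m,k,η₁,η₂}(D) = |Pr[D(A, As + e) = 1] − Pr[D(A, b) = 1]|`,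
`(s, e) ← β^k_{η₁} × β^m_{η₂}`, `b ← R_q^m`. [cite: AvanziEtAl2021KyberSpec, §4.3–§4.4] -/
def binomialMLWEAdvantage₂ (k η₁ η₂ m : ℕ) (D : LWE.Distinguisher (Fin k) (Rq K q) m) : ℝ :=
  |(LWE.acceptProb D (binomialMLWESamples₂ b q k η₁ η₂ m)).toReal -
    (LWE.acceptProb D (LWE.uniformSamples (Fin k) (Rq K q) m)).toReal|

/-- `Adv^{mlwe}_{m,k,η,η} = Adv^{mlwe}_{m,k,η}`. [cite: AvanziEtAl2021KyberSpec, §4.3 (Adv^mlwe_{m,k,η})] -/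
theorem binomialMLWEAdvantage₂_self (k η m : ℕ) (D : LWE.Distinguisher (Fin k) (Rq K q) m) :
    binomialMLWEAdvantage₂ b q k η η m D = binomialMLWEAdvantage b q k η m D := rfl

end RingLWE

namespace MLKEM

/-- `Compress_q(x, d)` of a ring element `x ∈ R_q`, coefficient-wise in the `ℤ`-basis `b` (Kyber §1.1:
"When `Compress_q` or `Decompress_q` is used with `x ∈ R_q` or `x ∈ R_q^k`, the procedure is applied to
each coefficient individually"): the vector `(Compress_q(xᵢ, d))ᵢ ∈ ℤ_{2^d}^n`. It is
`RingLWR.roundCoords b q (2^d)` (coefficient-wise LWR rounding). [cite: AvanziEtAl2021KyberSpec, §1.1 (Compress applied to each coefficient)] -/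
def compressRq (d : ℕ) (x : RingLWE.Rq K q) : Fin n → ZMod (2 ^ d) :=
  fun i ↦ compress q d (rqCoords b q x i)

omit [NumberField K] [NeZero q] in
/-- `compressRq` is the coefficient-wise LWR rounding `RingLWR.roundCoords b q (2^d)` of `ModuleLWR.lean`.
[cite: AvanziEtAl2021KyberSpec, §1.1 (Compress applied to each coefficient)] -/
theorem compressRq_eq_roundCoords (d : ℕ) : compressRq b q d = RingLWR.roundCoords b q (2 ^ d) := rfl

/-- The Module-LWER VIEW of `m` samples: `(aᵢ, bᵢ)ᵢ ↦ (aᵢ, Compress_q(bᵢ, d))ᵢ` — what the adversary is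
given in both branches of `Adv^{mlwer}`. [cite: AvanziEtAl2021KyberSpec, §4.4 (A(A, Compress_q(b, d)))] -/
def lwerView (k d m : ℕ) (v : Fin m → (Fin k → RingLWE.Rq K q) × RingLWE.Rq K q) :
    Fin m → (Fin k → RingLWE.Rq K q) × (Fin n → ZMod (2 ^ d)) :=
  fun i ↦ ((v i).1, compressRq b q d (v i).2)

/-- A (randomised) Module-LWER distinguisher on `m` compressed samples. [cite: AvanziEtAl2021KyberSpec, §4.4 (algorithm A breaking Module-LWER)] -/
abbrev LWERDistinguisher (k d m : ℕ) : Type :=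
  (Fin m → (Fin k → RingLWE.Rq K q) × (Fin n → ZMod (2 ^ d))) → PMF Bool

/-- **Kyber's Module-LWER advantage** `Adv^{mlwer}_{m,k,η₁,η₂,d}(A) = |Pr[A(A, Compress_q(As + e, d)) = 1] −
Pr[A(A, Compress_q(b, d)) = 1]|`, `A ← R_q^{m×k}`, `(s, e) ← β^k_{η₁} × β^m_{η₂}`, `b ← R_q^m`.
[cite: AvanziEtAl2021KyberSpec, §4.4 (Adv^mlwer_{m,k,η₁,η₂,d})] -/
def mlwerAdvantage (k η₁ η₂ d m : ℕ) (A : LWERDistinguisher (K := K) (n := n) q k d m) : ℝ :=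
  |(LWE.acceptProb A ((RingLWE.binomialMLWESamples₂ b q k η₁ η₂ m).map (lwerView b q k d m))).toReal -
    (LWE.acceptProb A ((LWE.uniformSamples (Fin k) (RingLWE.Rq K q) m).map (lwerView b q k d m))).toReal|

/-- Running `A` on transformed samples = running `A ∘ T` on the samples. [folklore] -/
private theorem acceptProb_map {β γ : Type} (A : γ → PMF Bool) (T : β → γ) (P : PMF β) :
    LWE.acceptProb A (P.map T) = LWE.acceptProb (fun x ↦ A (T x)) P := by
  rw [LWE.acceptProb, LWE.acceptProb, PMF.bind_map]
  rfl

/-- **An MLWER distinguisher is an MLWE distinguisher**: `Adv^{mlwer}_{m,k,η₁,η₂,d}(A) =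
Adv^{mlwe}_{m,k,η₁,η₂}(A ∘ Compress)` — `Compress_q(·, d)` is a public deterministic map of the samples, so
composing with it turns `A` into a Module-LWE distinguisher with the same advantage (the formal core of
"any algorithm … for Module-LWE[R] implies an algorithm …"). [cite: AvanziEtAl2021KyberSpec, §4.4 (Module-LWER vs Module-LWE)] -/
theorem mlwerAdvantage_eq_mlweAdvantage₂ (k η₁ η₂ d m : ℕ) (A : LWERDistinguisher (K := K) (n := n) q k d m) :
    mlwerAdvantage b q k η₁ η₂ d m A =
      RingLWE.binomialMLWEAdvantage₂ b q k η₁ η₂ m (fun v ↦ A (lwerView b q k d m v)) := by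
  rw [mlwerAdvantage, RingLWE.binomialMLWEAdvantage₂, acceptProb_map, acceptProb_map]

/-- Hence Module-LWER`(η₁, η₂, d)` is at least as hard as Module-LWE`(η₁, η₂)`: every MLWER advantage is an
MLWE advantage (of the composed distinguisher), so it is bounded by any bound on the latter.
[cite: AvanziEtAl2021KyberSpec, §4.4 (Module-LWER vs Module-LWE)] -/
theorem mlwerAdvantage_le (k η₁ η₂ d m : ℕ) {ε : ℝ}
    (hε : ∀ D : LWE.Distinguisher (Fin k) (RingLWE.Rq K q) m, RingLWE.binomialMLWEAdvantage₂ b q k η₁ η₂ m D ≤ ε)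
    (A : LWERDistinguisher (K := K) (n := n) q k d m) : mlwerAdvantage b q k η₁ η₂ d m A ≤ ε := by
  rw [mlwerAdvantage_eq_mlweAdvantage₂]
  exact hε _

/-- One-parameter case (`η₁ = η₂ = η`, e.g. ML-KEM-768/1024): `Adv^{mlwer}_{m,k,η,η,d}(A) =
Adv^{mlwe}_{m,k,η}(A ∘ Compress)` with the tree's `RingLWE.binomialMLWEAdvantage`.
[cite: AvanziEtAl2021KyberSpec, §4.3–§4.4] -/
theorem mlwerAdvantage_eq_mlweAdvantage (k η d m : ℕ) (A : LWERDistinguisher (K := K) (n := n) q k d m) :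
    mlwerAdvantage b q k η η d m A =
      RingLWE.binomialMLWEAdvantage b q k η m (fun v ↦ A (lwerView b q k d m v)) := by
  rw [mlwerAdvantage_eq_mlweAdvantage₂, RingLWE.binomialMLWEAdvantage₂_self]

end MLKEM

/-! ### `η₁ ≥ η₂`: Module-LWER is at least as hard as Module-LWE with secret AND error width `η₂`

Kyber spec §4.4 (p. 22), verbatim: "First, when `η₁ ≥ η₂`, any algorithm `B` for Module-LWE implies an
algorithm `A` for Module-LWER such that `Adv^{mlwer}_{m,k,η₁,η₂,d}(A) ≤ Adv^{mlwe}_{m,k,η₂}(B)`. When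
`η₁ > η₂`, as in the Kyber512 parameter set, the preceding inequality ignores the fact that having a
larger `s` in the Module-LWER instance makes the short target lattice vector longer. And when
`d < log q`, the inequality similarly ignores the fact that the adversary `A` only gets to see
`(A, t = Compress_q(As + e, d))` rather than `(A, As + e)`. If we use this rough inequality, then for
our Kyber512 parameters we would have the Core-SVP classical hardness of the Module-LWER problem be 112.
So the logarithm of the required number of gates stated in the Kyber512 column of Table 4 would decrease
by 6 to approximately 145."

The specification prints no proof. The argument formalised here is the folklore secret
re-randomisation: the centred binomial law is ADDITIVE in its parameter — `B_{η₂+δ}` is the law of an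
independent sum `x + y`, `x ← B_{η₂}`, `y ← B_δ`, because `B_η` is the sum of `η` i.i.d. terms `aᵢ − bᵢ`
(§1.1) — hence so are `D_η(R_q)` (coefficient-wise) and its `k`-fold product; so MLWE samples
`(A, As + e)` with `s ← β^k_{η₂}` become MLWE samples with secret `s + t ← β^k_{η₂+δ}` after the public
shift `(aᵢ, bᵢ) ↦ (aᵢ, bᵢ + ⟨aᵢ, t⟩)` by one fresh `t ← β^k_δ` (Regev 2009, proof of Lemma 4.1; the
tree's `LWE.shiftSample`, `LWE.lweSamples_map_shift`), while uniform samples stay uniform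
(`LWE.uniformSamples_map_shift`). Composing with `Compress` turns every MLWER adversary `A` into the MLWE
distinguisher `MLKEM.rerandThen A` with EQUAL advantage. -/

namespace LWE

open Literature.Probability.Distributions

section SumLaw

variable {α β γ : Type}

/-- The law of the sum `x + y` of an INDEPENDENT pair `x ← P`, `y ← Q`: the push-forward of the product
law `prodLaw P Q` along `+`; by `PMF.map_bind`/`PMF.map_comp` it unfolds to the monadic form
`P.bind fun x ↦ Q.map fun y ↦ x + y` (on a finite ring the same operation as `LWE.MP12.addConv`). The
generic lemmas about it below are file-private plumbing. [folklore] -/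
def sumLaw [Add α] (P Q : PMF α) : PMF α :=
  (prodLaw P Q).map fun z ↦ z.1 + z.2

/-- `sumLaw` in monadic form: draw `x ← P`, then `y ← Q`, return `x + y`. [folklore] -/
private theorem sumLaw_eq_bind [Add α] (P Q : PMF α) :
    sumLaw P Q = P.bind fun x ↦ Q.map fun y ↦ x + y := by
  rw [sumLaw, prodLaw, PMF.map_bind]
  refine congrArg _ (funext fun x ↦ ?_)
  rw [PMF.map_comp]
  rfl

/-- The push-forward of an independent pair along `(x, y) ↦ f x + g y` is the sum law of the
push-forwards `f x`, `g y`. [folklore] -/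
private theorem prodLaw_map_add [Add β] (P : PMF α) (Q : PMF γ) (f : α → β) (g : γ → β) :
    (prodLaw P Q).map (fun z ↦ f z.1 + g z.2) = sumLaw (P.map f) (Q.map g) := by
  rw [sumLaw, ← prodLaw_map_prodMap, PMF.map_comp]
  rfl

/-- The push-forward of a sum law along an additive map is the sum law of the push-forwards. [folklore] -/
private theorem sumLaw_map [Add α] [Add β] (P Q : PMF α) (φ : α → β) (hφ : ∀ x y, φ (x + y) = φ x + φ y) :
    (sumLaw P Q).map φ = sumLaw (P.map φ) (Q.map φ) := by
  rw [← prodLaw_map_add, sumLaw, PMF.map_comp]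
  congr 1
  funext z
  exact hφ z.1 z.2

/-- **Coordinate-wise sums of two independent iid tuples form an iid tuple of independent sums**:
`(sumLaw P Q)^{⊗m} = sumLaw P^{⊗m} Q^{⊗m}` (pointwise addition of tuples; zip the two tuples,
`prodLaw_iidPMF_map_zip`, then add each pair). [folklore] -/
private theorem iidPMF_sumLaw [Add α] (P Q : PMF α) (m : ℕ) :
    iidPMF (sumLaw P Q) m = sumLaw (iidPMF P m) (iidPMF Q m) := by
  rw [sumLaw, ← iidPMF_map, ← prodLaw_iidPMF_map_zip, PMF.map_comp, sumLaw]
  rfl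

end SumLaw

end LWE

/-! #### Additivity of the centred binomial law in `η` -/

/-- **`B_{a+d} = B_a ⋆ B_d`**: the centred binomial law with parameter `a + d` is the law of the sum of
INDEPENDENT `x ← B_a` and `y ← B_d` — split the `2(a+d)` uniform bits of §1.1's
"`(a_1, …, a_η, b_1, …, b_η) ← {0,1}^{2η}`, output `∑ (a_i − b_i)`" into the first `a` and the last `d`
indices. [cite: AvanziEtAl2021KyberSpec, §1.1 (B_η as a sum of η i.i.d. terms a_i − b_i)] -/
theorem centeredBinomial_add (a d : ℕ) :
    centeredBinomial (a + d) = LWE.sumLaw (centeredBinomial a) (centeredBinomial d) := by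
  classical
  let e : ((Fin a → Bool) × (Fin a → Bool)) × ((Fin d → Bool) × (Fin d → Bool)) ≃
      (Fin (a + d) → Bool) × (Fin (a + d) → Bool) :=
    (Equiv.prodProdProdComm _ _ _ _).trans ((Fin.appendEquiv a d).prodCongr (Fin.appendEquiv a d))
  unfold centeredBinomial
  rw [← LWE.uniformOfFintype_map_of_bijective e.bijective, PMF.map_comp, ← LWE.prodLaw_uniformOfFintype,
    ← LWE.prodLaw_map_add]
  congr 1
  funext p
  simp only [Function.comp_apply, e, Equiv.trans_apply, Equiv.prodCongr_apply, Equiv.prodProdProdComm_apply,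
    Prod.map_apply, Fin.appendEquiv_apply, Fin.sum_univ_add, Fin.append_left, Fin.append_right]
  ring

namespace RingLWE

omit [NumberField K] [NeZero q] in
/-- `ofIntCoords b q` is additive: `(∑ (zᵢ + wᵢ) bᵢ) mod q = (∑ zᵢ bᵢ) mod q + (∑ wᵢ bᵢ) mod q`.
[cite: NISTFIPS203, §4.2.2 (coefficient array of a sampled polynomial)] -/
theorem ofIntCoords_add (z w : Fin n → ℤ) :
    ofIntCoords b q (z + w) = ofIntCoords b q z + ofIntCoords b q w := by
  simp only [ofIntCoords, Pi.add_apply, add_smul, Finset.sum_add_distrib, map_add]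

omit [NumberField K] [NeZero q] in
/-- **`D_{a+d}(R_q) = D_a(R_q) ⋆ D_d(R_q)`**: an element of `R_q` with i.i.d. `B_{a+d}` coordinates is the
sum of INDEPENDENT elements with i.i.d. `B_a` and `B_d` coordinates (`centeredBinomial_add` coordinate-wise,
`LWE.iidPMF_sumLaw`, and additivity of `ofIntCoords`). [cite: AvanziEtAl2021KyberSpec, §1.1 (B_η coefficient-wise; B_η a sum of η i.i.d. terms)] -/
theorem binomialRq_add (a d : ℕ) :
    binomialRq b q (a + d) = LWE.sumLaw (binomialRq b q a) (binomialRq b q d) := by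
  rw [binomialRq, binomialRq, binomialRq, centeredBinomial_add, LWE.iidPMF_sumLaw,
    LWE.sumLaw_map _ _ _ (ofIntCoords_add b q)]

/-- The MLWE branch with secret width `η₂ + δ` is the branch with secret width `η₂` followed by the
PUBLIC re-randomisation `S ↦ shiftSample t ∘ S` with an independent `t ← β^k_δ`
(`β^k_{η₂+δ} = β^k_{η₂} ⋆ β^k_δ` and `A_{s,χ}^m ∘ f_t⁻¹ = A_{s+t,χ}^m`, `LWE.lweSamples_map_shift`).
[cite: AvanziEtAl2021KyberSpec, §4.4 p. 22 (Adv^mlwer ≤ Adv^mlwe_{m,k,η₂} when η₁ ≥ η₂)] -/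
theorem binomialMLWESamples₂_add_bind {γ : Type} (k η₂ δ m : ℕ)
    (F : (Fin m → (Fin k → Rq K q) × Rq K q) → PMF γ) :
    (binomialMLWESamples₂ b q k (η₂ + δ) η₂ m).bind F =
      (binomialMLWESamples b q k η₂ m).bind fun S ↦
        (LWE.iidPMF (binomialRq b q δ) k).bind fun t ↦ F (LWE.shiftSample t ∘ S) := by
  rw [binomialMLWESamples₂, binomialMLWESamples, binomialRq_add, LWE.iidPMF_sumLaw, LWE.sumLaw_eq_bind,
    PMF.bind_bind, PMF.bind_bind, PMF.bind_bind]
  refine congrArg _ (funext fun s ↦ ?_)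
  rw [PMF.bind_map, PMF.bind_comm (LWE.lweSamples (binomialRq b q η₂) s m)]
  refine congrArg _ (funext fun t ↦ ?_)
  rw [Function.comp_apply, ← LWE.lweSamples_map_shift, PMF.bind_map]
  rfl

end RingLWE

namespace MLKEM

/-- **The reduction behind `Adv^{mlwer}_{m,k,η₂+δ,η₂,d} ≤ Adv^{mlwe}_{m,k,η₂}`**: on `m` samples
`S = (aᵢ, bᵢ)ᵢ` draw ONE fresh `t ← β^k_δ`, shift every sample `(aᵢ, bᵢ) ↦ (aᵢ, bᵢ + ⟨aᵢ, t⟩)`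
(`LWE.shiftSample t`: the secret becomes `s + t`), compress (`lwerView`), and run the MLWER adversary `A`.
[cite: AvanziEtAl2021KyberSpec, §4.4 p. 22 (Adv^mlwer ≤ Adv^mlwe_{m,k,η₂} when η₁ ≥ η₂)] -/
def rerandThen (k δ d m : ℕ) (A : LWERDistinguisher (K := K) (n := n) q k d m) :
    LWE.Distinguisher (Fin k) (RingLWE.Rq K q) m :=
  fun S ↦ (LWE.iidPMF (RingLWE.binomialRq b q δ) k).bind fun t ↦
    A (lwerView b q k d m (LWE.shiftSample t ∘ S))

omit [NumberField K] [NeZero q] in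
/-- Running `rerandThen A` on a law `P` of sample tuples: draw `t`, push `P` forward along the shift by
`t`, compress, run `A`. [folklore] -/
private theorem bind_rerandThen (k δ d m : ℕ) (A : LWERDistinguisher (K := K) (n := n) q k d m)
    (P : PMF (Fin m → (Fin k → RingLWE.Rq K q) × RingLWE.Rq K q)) :
    P.bind (rerandThen b q k δ d m A) =
      (LWE.iidPMF (RingLWE.binomialRq b q δ) k).bind fun t ↦
        (P.map fun S ↦ LWE.shiftSample t ∘ S).bind fun S ↦ A (lwerView b q k d m S) := by
  unfold rerandThen
  rw [PMF.bind_comm]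
  refine congrArg _ (funext fun t ↦ ?_)
  rw [PMF.bind_map]
  rfl

/-- On the MLWE branch with both widths `η₂`, `rerandThen A` sees exactly what `A` sees on the MLWER
branch with widths `(η₂ + δ, η₂)`. [cite: AvanziEtAl2021KyberSpec, §4.4 p. 22 (Adv^mlwer ≤ Adv^mlwe_{m,k,η₂} when η₁ ≥ η₂)] -/
theorem binomialMLWESamples_bind_rerandThen (k η₂ δ d m : ℕ)
    (A : LWERDistinguisher (K := K) (n := n) q k d m) :
    (RingLWE.binomialMLWESamples b q k η₂ m).bind (rerandThen b q k δ d m A) =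
      ((RingLWE.binomialMLWESamples₂ b q k (η₂ + δ) η₂ m).map (lwerView b q k d m)).bind A := by
  rw [PMF.bind_map, RingLWE.binomialMLWESamples₂_add_bind]
  rfl

/-- On uniform samples, `rerandThen A` sees exactly what `A` sees on compressed uniform samples (each
shift `f_t` preserves the uniform law, `LWE.uniformSamples_map_shift`). [cite: AvanziEtAl2021KyberSpec, §4.4 p. 22 (Adv^mlwer ≤ Adv^mlwe_{m,k,η₂} when η₁ ≥ η₂)] -/
theorem uniformSamples_bind_rerandThen (k δ d m : ℕ) (A : LWERDistinguisher (K := K) (n := n) q k d m) :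
    (LWE.uniformSamples (Fin k) (RingLWE.Rq K q) m).bind (rerandThen b q k δ d m A) =
      ((LWE.uniformSamples (Fin k) (RingLWE.Rq K q) m).map (lwerView b q k d m)).bind A := by
  rw [bind_rerandThen]
  simp_rw [LWE.uniformSamples_map_shift]
  rw [PMF.bind_const, PMF.bind_map]
  rfl

/-- **`Adv^{mlwer}_{m,k,η₂+δ,η₂,d}(A) = Adv^{mlwe}_{m,k,η₂}(rerandThen A)`** — the exact form of the
specification's "when `η₁ ≥ η₂`, … `Adv^{mlwer}_{m,k,η₁,η₂,d}(A) ≤ Adv^{mlwe}_{m,k,η₂}(B)`": the MLWE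
distinguisher is explicit and loses nothing. [cite: AvanziEtAl2021KyberSpec, §4.4 p. 22 (Adv^mlwer ≤ Adv^mlwe_{m,k,η₂} when η₁ ≥ η₂)] -/
theorem mlwerAdvantage_eq_mlweAdvantage_rerandThen (k η₂ δ d m : ℕ)
    (A : LWERDistinguisher (K := K) (n := n) q k d m) :
    mlwerAdvantage b q k (η₂ + δ) η₂ d m A =
      RingLWE.binomialMLWEAdvantage b q k η₂ m (rerandThen b q k δ d m A) := by
  unfold mlwerAdvantage RingLWE.binomialMLWEAdvantage LWE.acceptProb
  rw [binomialMLWESamples_bind_rerandThen, uniformSamples_bind_rerandThen]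

/-- **Kyber spec §4.4, p. 22 — Module-LWER`(η₁, η₂, d)` is at least as hard as Module-LWE`(η₂)` when
`η₁ ≥ η₂`**: for every MLWER adversary `A` there is a Module-LWE distinguisher `B` against secret AND
error width `η₂` (namely `rerandThen A` with `δ = η₁ − η₂`) with
`Adv^{mlwer}_{m,k,η₁,η₂,d}(A) ≤ Adv^{mlwe}_{m,k,η₂}(B)`. [cite: AvanziEtAl2021KyberSpec, §4.4 p. 22 (Adv^mlwer ≤ Adv^mlwe_{m,k,η₂} when η₁ ≥ η₂)] -/
theorem exists_mlwe_of_mlwer {η₁ η₂ : ℕ} (h : η₂ ≤ η₁) (k d m : ℕ)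
    (A : LWERDistinguisher (K := K) (n := n) q k d m) :
    ∃ B : LWE.Distinguisher (Fin k) (RingLWE.Rq K q) m,
      mlwerAdvantage b q k η₁ η₂ d m A ≤ RingLWE.binomialMLWEAdvantage b q k η₂ m B := by
  obtain ⟨δ, rfl⟩ := Nat.exists_eq_add_of_le h
  exact ⟨rerandThen b q k δ d m A, (mlwerAdvantage_eq_mlweAdvantage_rerandThen b q k η₂ δ d m A).le⟩

/-- Hence any bound on Module-LWE`(η₂)` advantages bounds every Module-LWER`(η₁, η₂, d)` advantage,
`η₁ ≥ η₂` (the "rough inequality" by which the spec reads Kyber512's MLWER hardness off MLWE with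
`η = η₂ = 2`: Core-SVP 112). [cite: AvanziEtAl2021KyberSpec, §4.4 p. 22 (rough inequality, Core-SVP 112)] -/
theorem mlwerAdvantage_le_of_mlwe {η₁ η₂ : ℕ} (h : η₂ ≤ η₁) (k d m : ℕ) {ε : ℝ}
    (hε : ∀ D : LWE.Distinguisher (Fin k) (RingLWE.Rq K q) m, RingLWE.binomialMLWEAdvantage b q k η₂ m D ≤ ε)
    (A : LWERDistinguisher (K := K) (n := n) q k d m) : mlwerAdvantage b q k η₁ η₂ d m A ≤ ε := by
  obtain ⟨B, hB⟩ := exists_mlwe_of_mlwer b q h k d m A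
  exact hB.trans (hε B)

/-- **ML-KEM-512 / Kyber512 instance** (`R_q = ℤ_3329[X]/(X^256 + 1)` as `𝓞(ℚ(ζ_512)) ⧸ (3329)` with the
power basis; `(m, k, η₁, η₂, d) = (k + 1, k, η₁, η₂, d_u) = (3, 2, 3, 2, 10)`, the parameters of the term
`Adv^{mlwer}_{k+1,k,η₁,η₂,d_u}` in eq. (6)): every such MLWER adversary is matched by an ML-KEM Module-LWE
distinguisher with `η = 2` of at least the same advantage. [cite: AvanziEtAl2021KyberSpec, §4.4 eq. (6) and p. 22 (Kyber512: η₁ = 3 > η₂ = 2, d_u = 10)] -/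
theorem mlkem512_exists_mlwe_of_mlwer
    (A : LWERDistinguisher (K := CyclotomicField (2 ^ 9) ℚ) (n := (cyclotomicPowerBasis 9).dim) MLKEM.q 2 10 3) :
    ∃ B : LWE.Distinguisher (Fin 2) (RingLWE.Rq (CyclotomicField (2 ^ 9) ℚ) MLKEM.q) 3,
      mlwerAdvantage (cyclotomicPowerBasis 9).basis MLKEM.q 2 3 2 10 3 A ≤ MLKEM.mlweAdvantage 2 2 3 B :=
  exists_mlwe_of_mlwer (cyclotomicPowerBasis 9).basis MLKEM.q (by norm_num) 2 10 3 A

end MLKEM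

/-! #### `n`-fold additivity: the law of a SUM of iid centred binomial coefficients

The coefficient sum `e(1) = ∑ᵢ eᵢ` of a polynomial with `n` iid `B_η` coefficients (the image of a
`D_η(R_q)`-distributed error under evaluation at a root `x = 1` of the modulus polynomial, e.g. over
`ℤ_q[x]/(xⁿ − 1)`) is `B_{nη}`: the `2nη` uniform bits of the `n` coefficients are the `2nη` bits of one
centred binomial sample. This is `centeredBinomial_add` iterated along the tree's `LWE.iidPMF`. -/

/-- **`∑ᵢ₌₁ⁿ B_η = B_{nη}`** (independent summands): the push-forward of the iid law `B_η^{⊗n}` along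
`v ↦ ∑ i, v i` is `B_{n·η}` — §1.1's definition of `B_η` as a sum of `η` iid terms `aᵢ − bᵢ`, regrouped.
[cite: AvanziEtAl2021KyberSpec, §1.1 (B_η = ∑_{i=1}^{η}(a_i − b_i), (a, b) ← {0,1}^{2η})] [cite: NISTFIPS203, §4.2.2 Algorithm 8 (SamplePolyCBD_η)] -/
theorem iidPMF_centeredBinomial_map_sum (η : ℕ) :
    ∀ n : ℕ, (LWE.iidPMF (centeredBinomial η) n).map (fun v ↦ ∑ i, v i) = centeredBinomial (n * η)
  | 0 => by
    rw [LWE.iidPMF_zero, PMF.pure_map, Nat.zero_mul, centeredBinomial_zero]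
    simp
  | n + 1 => by
    rw [LWE.iidPMF_succ, PMF.map_bind, Nat.succ_mul, add_comm (n * η) η, centeredBinomial_add,
      LWE.sumLaw_eq_bind, ← iidPMF_centeredBinomial_map_sum η n]
    refine congrArg _ (funext fun x ↦ ?_)
    rw [PMF.map_comp, PMF.map_comp]
    congr 1
    funext v
    simp [Fin.sum_cons]

end Literature.Computability.Cryptography
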